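import Literature.MathematicalPhysics.QuantumFieldTheory.Balaban1983to89.Setup

/-!
# `Balaban1983to89.B14LocalCoupling` — [Balaban1988Convergent] (1.27) p. 253 and (2.24) p. 259:
the position-dependent inverse coupling `1/g_j²(x)` of the renormalized effective action

statement-level skeleton of published theorems with citation tags; proofs where landed; nothing here is a
claim about the Yang–Mills mass gap

CITATION HEADER (lean-in-tree rule).  Source: T. Bałaban, *Convergent renormalization expansions for lattice gauge
theories*, Commun. Math. Phys. **119**, 243–285 (1988), doi:10.1007/bf01217741 [Balaban1988Convergent] (cell paper
B14 = "[III]"; held `paper:balaban1988-cmp119-convergent-renormalization`, journal page = PDF page + 242; the two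
displays below were read on the x2 renders `…-p011-x2.png` (p. 253) and `…-p017-x2.png` (p. 259) of
`run/shared/lean/pub/pub-balaban/b2b-balaban-ref1/pages/1988-cmp119-convergent-renormalization/`).
Mega-formalization `lit-balaban`, reader/typer unit `lit-balaban-r11` (CMP 119), SKELETON rows B14-1.27 / B14-2.24.

THE PRINTED TEXT (verbatim).
* p. 253 [PDF 11]: *"The final step is renormalization of the effective action. We renormalize it in the region Λ₁
  subtracting the values at U₁ = 1, and the counterterm β₁(g₀)A(φ₁, U₁), where β₁(g₀) was defined in [I] by the
  formulas (1.41)–(1.43), φ₁ ∈ C₀^∞(Λ₁), φ₁ = 1 on Λ₁^{∼−1}. … Let us write the first renormalization group equation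
  1/g₀² = 1/g₁²(x) + β₁(g₀)φ₁(x). (1.27)  The difference in comparison with Eq. (I.0.20) is that here we have
  functions on the lattice T instead of the constants there, but on Λ₁^{∼−1} we have the same equation, which defines
  the same coupling constant g₁."*
* p. 259 [PDF 17]: *"We start the detailed description of the terms in the effective action (2.23) with the
  definition of the function g_k²(x). It is defined by the sequence of the renormalization group equations
  generalzing Eqs. (I.0.20) and (1.27):  1/g²_{j−1}(x) = 1/g_j²(x) + β_j(g_{j−1})φ_j(x). (2.24)  Here the coupling
  constants g_{j−1} are defined as in (I.0.20), and φ_j ∈ C₀^∞(Λ_j), φ_j = 1 on Λ_j^{∼−1}. Thus g_j²(x) = g_j² on the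
  last domain."*
* (I.0.20) = [Balaban1987RG1] (0.20) p. 256 is `Flow.SatisfiesRG` of `…Balaban1983to89.Setup`:
  `1/g_k² = 1/g_{k+1}² + β_{k+1}(g_k)`.

WHAT IS TYPED.  Over the cell's coupling/β carrier `Setup.Flow` and an ABSTRACT point type `X` (the sites of the
lattice `T`; the cut-off functions `φ_j : X → ℝ` are data — their smoothness `C₀^∞(Λ_j)` and the geometry of
`Λ_j^{∼−1}` are not modelled here, exactly as `B14Seam245` treats `φ_j`): the recursion (2.24) solved for the new
inverse coupling, `invSq F φ j x = 1/g_j²(x)` (`invSq F φ 0 x = 1/g₀²`, the bare constant), its closed form, and the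
two printed consequences KERNEL-CHECKED: (a) p. 259 *"g_j²(x) = g_j² on the last domain"* — at a point where
`φ_i(x) = 1` for `i = 1, …, j` the function equals the constant `1/g_j²` of (I.0.20) (`invSq_eq_const_of_phi_eq_one`);
(b) the general defect identity `1/g_j²(x) − 1/g_j² = Σ_{i=1}^{j} β_i(g_{i−1})(1 − φ_i(x))` under (I.0.20)
(`invSq_sub_const`), of which (a) is the case of vanishing summands and which is the algebra behind p. 277's
*"supp(g_k^{−2}(·) − g_k^{−2}) ⊂ Z_k"*.  Nothing printed is asserted beyond these identities; no `sorry`, no axiom.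
-/

namespace Literature.MathematicalPhysics.QuantumFieldTheory.Balaban1983to89.B14.LocalCoupling

open Literature.MathematicalPhysics.QuantumFieldTheory.Balaban1983to89
open scoped BigOperators

variable {X : Type*}

/-- **(1.27) p. 253 / (2.24) p. 259**, the position-dependent inverse coupling `1/g_j²(x)`, defined by the recursion
*"1/g²_{j−1}(x) = 1/g_j²(x) + β_j(g_{j−1})φ_j(x) (2.24)"* started from the bare constant `1/g₀²(x) = 1/g₀²`
((1.27) is the case `j = 1`).  `F : Setup.Flow` carries `g_j` and `β_j`; `φ j : X → ℝ` is the cut-off function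
`φ_j` (`φ 0` is never used). [cite: Balaban1988Convergent, (1.27) p.253, (2.24) p.259] -/
noncomputable def invSq (F : Flow) (φ : ℕ → X → ℝ) : ℕ → X → ℝ
  | 0, _ => 1 / (F.g 0) ^ 2
  | j + 1, x => invSq F φ j x - F.β (j + 1) (F.g j) * φ (j + 1) x

/-- The recursion (2.24) in its printed orientation: `1/g²_{j−1}(x) = 1/g_j²(x) + β_j(g_{j−1})φ_j(x)`, here with
`j − 1 ↦ j`, `j ↦ j+1`. [cite: Balaban1988Convergent, (2.24) p.259] -/
theorem invSq_rec (F : Flow) (φ : ℕ → X → ℝ) (j : ℕ) (x : X) :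
    invSq F φ j x = invSq F φ (j + 1) x + F.β (j + 1) (F.g j) * φ (j + 1) x := by
  simp [invSq]

/-- (1.27) verbatim shape: `1/g₀² = 1/g₁²(x) + β₁(g₀)φ₁(x)`. [cite: Balaban1988Convergent, (1.27) p.253] -/
theorem eq127 (F : Flow) (φ : ℕ → X → ℝ) (x : X) :
    1 / (F.g 0) ^ 2 = invSq F φ 1 x + F.β 1 (F.g 0) * φ 1 x := by
  simp [invSq]

/-- Closed form of (2.24): `1/g_j²(x) = 1/g₀² − Σ_{i<j} β_{i+1}(g_i) φ_{i+1}(x)`. [cite: Balaban1988Convergent, (2.24) p.259] -/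
theorem invSq_eq_sub_sum (F : Flow) (φ : ℕ → X → ℝ) (j : ℕ) (x : X) :
    invSq F φ j x = 1 / (F.g 0) ^ 2 - ∑ i ∈ Finset.range j, F.β (i + 1) (F.g i) * φ (i + 1) x := by
  induction j with
  | zero => simp [invSq]
  | succ j ih => rw [invSq, ih, Finset.sum_range_succ]; ring

/-- The constant couplings of (I.0.20) in closed form: under `Flow.SatisfiesRG F K`,
`1/g_j² = 1/g₀² − Σ_{i<j} β_{i+1}(g_i)` for `j ≤ K`. [cite: Balaban1987RG1, (0.20) p.256] -/
theorem const_invSq_eq_sub_sum (F : Flow) {K j : ℕ} (hRG : F.SatisfiesRG K) (hj : j ≤ K) :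
    1 / (F.g j) ^ 2 = 1 / (F.g 0) ^ 2 - ∑ i ∈ Finset.range j, F.β (i + 1) (F.g i) := by
  induction j with
  | zero => simp
  | succ j ih =>
    have h1 : j < K := Nat.lt_of_succ_le hj
    have h2 := hRG j h1
    rw [Finset.sum_range_succ, ← sub_sub, ← ih (le_of_lt h1), h2]
    ring

/-- **The defect identity behind (2.24)**: under (I.0.20), `1/g_j²(x) − 1/g_j² = Σ_{i<j} β_{i+1}(g_i)(1 − φ_{i+1}(x))`
for `j ≤ K` — the position dependence of the coupling is carried exactly by the places where the cut-offs differ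
from `1` (cf. p. 277: *"because supp(g_k^{−2}(·) − g_k^{−2}) ⊂ Z_k"*). [cite: Balaban1988Convergent, (2.24) p.259, p.277] -/
theorem invSq_sub_const (F : Flow) (φ : ℕ → X → ℝ) {K j : ℕ} (hRG : F.SatisfiesRG K) (hj : j ≤ K) (x : X) :
    invSq F φ j x - 1 / (F.g j) ^ 2 =
      ∑ i ∈ Finset.range j, F.β (i + 1) (F.g i) * (1 - φ (i + 1) x) := by
  rw [invSq_eq_sub_sum, const_invSq_eq_sub_sum F hRG hj]
  simp only [mul_sub, mul_one, Finset.sum_sub_distrib]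
  ring

/-- **p. 259, verbatim: *"Thus g_j²(x) = g_j² on the last domain."***  At a point `x` where every cut-off
`φ_i(x) = 1`, `i = 1, …, j` (the printed situation on `Λ_j^{∼−1}`, where `φ_j = 1` and, the domains being nested,
all earlier `φ_i = 1`), the recursion (2.24) reproduces the constant coupling of (I.0.20): `1/g_j²(x) = 1/g_j²`.
For `j = 1` this is p. 253: *"on Λ₁^{∼−1} we have the same equation, which defines the same coupling constant g₁."*
[cite: Balaban1988Convergent, (2.24) p.259, (1.27) p.253] -/
theorem invSq_eq_const_of_phi_eq_one (F : Flow) (φ : ℕ → X → ℝ) {K j : ℕ} (hRG : F.SatisfiesRG K) (hj : j ≤ K)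
    (x : X) (hφ : ∀ i, 1 ≤ i → i ≤ j → φ i x = 1) : invSq F φ j x = 1 / (F.g j) ^ 2 := by
  have h := invSq_sub_const F φ hRG hj x
  have hz : ∑ i ∈ Finset.range j, F.β (i + 1) (F.g i) * (1 - φ (i + 1) x) = 0 := by
    apply Finset.sum_eq_zero
    intro i hi
    rw [hφ (i + 1) (Nat.succ_le_succ (Nat.zero_le i)) (Finset.mem_range.mp hi), sub_self, mul_zero]
  rw [hz] at h
  linarith

/-- Where NO cut-off has acted (`φ_i(x) = 0`, `i = 1, …, j`: a point outside every `Λ_i`), the coupling stays bare: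
`1/g_j²(x) = 1/g₀²` — the other end of (2.24). [cite: Balaban1988Convergent, (2.24) p.259] -/
theorem invSq_eq_bare_of_phi_eq_zero (F : Flow) (φ : ℕ → X → ℝ) (j : ℕ) (x : X)
    (hφ : ∀ i, 1 ≤ i → i ≤ j → φ i x = 0) : invSq F φ j x = 1 / (F.g 0) ^ 2 := by
  rw [invSq_eq_sub_sum]
  have hz : ∑ i ∈ Finset.range j, F.β (i + 1) (F.g i) * φ (i + 1) x = 0 := by
    apply Finset.sum_eq_zero
    intro i hi
    rw [hφ (i + 1) (Nat.succ_le_succ (Nat.zero_le i)) (Finset.mem_range.mp hi), mul_zero]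
  rw [hz, sub_zero]

end Literature.MathematicalPhysics.QuantumFieldTheory.Balaban1983to89.B14.LocalCoupling
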